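import Summits.AtomisticToContinuum.HydrodynamicLimit.Theses.JParityClosure
import Summits.AtomisticToContinuum.HydrodynamicLimit.Theorems.JParityClosureParityBandClosureCountableTestUpgradeA
import Summits.AtomisticToContinuum.HydrodynamicLimit.Theorems.JParityClosureParityBandClosureProductionZeroOfDetailedBalance
import Summits.AtomisticToContinuum.HydrodynamicLimit.Theorems.JParityClosureParityRigidityMollify
import Mathlib.MeasureTheory.Measure.Regular
import HarnessLib

/-!
# Countable determining test families (stub `stub_countableTestUpgrade`)

Stub of the line `transfer-weighted-parity-chain` (skeleton v3) of the crux
`JParityClosure.ParityBandClosure` (stmt-AtomisticToContinuum-17608): the waypoint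
`CountableTestUpgrade` — countable families of exact test identities already force the three
measure-level hypotheses of exact parity rigidity.

WHAT. `Q = (V3 × V3) × S²` is the collision-record space (pre-collisional pair, impact direction),
`J q = (collide q.2 q.1, −q.2)` the inverse collision, `B q = ((w − v)·ω)₊` the flux weight,
`h_ϑ = ν ⋆ G_{ϑ²}` the Gaussian KDE of a probability law `ν` on `V3 = ℝ³` and
`F_ϑ(q) = log h_ϑ(v) + log h_ϑ(w) − log h_ϑ(v′) − log h_ϑ(w′)` the surprisal jump (conventions
VERBATIM those of the skeleton / `ParityRigidity`). We EXHIBIT countably many bounded continuous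
`Φ_i` on `Q`, nonneg bounded continuous `Ξ_i` on `Q`, bounded continuous `c_i` on `V3` and
bandwidths `ϑ_k ∈ (0,1)` such that for every `ν` (finite second moment), finite record `κ` on `Q`
and `c₀ > 0`: (o) `∫ (Φ_i − Φ_i ∘ J) min(1, e^{−F_{ϑ_k}}) dκ = 0 ∀ i k` implies the vanishing of
`∫ Ψ min(1, e^{−F_ϑ}) dκ` for EVERY `ϑ ∈ (0,1)` and every bounded continuous `J`-odd `Ψ`;
(f) `c₀ ∫ Ξ_i B d((ν⊗ν)⊗σ) ≤ ∫ Ξ_i dκ ∀ i` implies `B · ((ν⊗ν)⊗σ) ≪ κ`; (b) `∫ Δc_i dκ = 0 ∀ i`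
implies the marginal identity `κ ∘ post₁⁻¹ + κ ∘ post₂⁻¹ = κ ∘ pre₁⁻¹ + κ ∘ pre₂⁻¹`.

PROOF SKETCH. The families are those of helper A
(`JParityClosureParityBandClosureCountableTestUpgradeA`): `Φ_i = Ξ_i = t_Q i`, `c_i = t_{V3} i`,
the countable DETERMINING families of `exists_testSeq` (outer approximations of indicators of the
complements of finite unions of basic open sets: `∫ t m dμ ≤ ∫ t m dμ' ∀ m` forces `μ ≤ μ'` on
closed sets, finite `μ, μ'`), and `ϑ_k` the dense bandwidth sequence `stub_countableTestUpgradeA`.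
(o) `integral_odd_mul_eq_zero`: with `w = min(1, e^{−F_{ϑ_k}})` the finite measures `w·κ` and
`(w·κ) ∘ J⁻¹` have equal integrals on the determining family (`integral_withDensity…`,
`integral_map`), hence coincide (`ext_of_integral_family`), so `∫ Ψ w dκ = ∫ Ψ∘J w dκ = −∫ Ψ w dκ`;
then `ϑ ↦ ∫ Ψ min(1, e^{−F_ϑ}) dκ` is continuous on `ϑ ≠ 0` (`continuousOn_oddIntegral`, fed with
`continuousOn_kde`, `integral_localMaxwellian_pos`, `measurable_integral_localMaxwellian`) and
vanishes on the dense set `{ϑ_k}`, hence on `(0,1)` (`eq_zero_of_mem_closure`).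
(f) `withDensity_fluxWeight_absolutelyContinuous`: `B ≤ |v| + |w|` makes `π = B·((ν⊗ν)⊗σ)` finite
(`ν` has a first moment); `c₀ ∫ t m dπ ≤ ∫ t m dκ` gives `c₀ π F ≤ κ F` on closed sets
(`smul_measure_isClosed_le_of_family`), and a `κ`-null set has only `π`-null closed subsets, hence is
`π`-null by inner regularity of the finite Borel measure `π` on the metric space `Q`
(`MeasurableSet.measure_eq_iSup_isClosed_of_ne_top`).
(b) `map_post_add_eq_map_pre_add`: the four push-forwards are finite measures on `V3`,
`integral_map` + `integral_add_measure` turn (b) into equality of integrals of the determining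
family against gain and loss marginals; `ext_of_integral_family`.

REFERENCES. P. Billingsley, *Convergence of Probability Measures*, 2nd ed. 1999, Thm 1.2, §2
(finite Borel measures on metric spaces are determined by closed sets; countable determining
classes on separable spaces); C. Cercignani, R. Illner, M. Pulvirenti, *The Mathematical Theory
of Dilute Gases*, 1994, §3.1–3.2 (micro-reversibility `J`, gain/loss balance).
-/

noncomputable section

namespace Summit.AtomisticToContinuum.HydrodynamicLimit.Theorems.ParityBandClosureCountableUpgrade

open scoped BigOperators Topology Classical MeasureTheory ENNReal NNReal InnerProductSpace
open scoped BoundedContinuousFunction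
open Filter Set MeasureTheory TopologicalSpace
open Literature.MathematicalPhysics.KineticTheory Literature.Analysis.FluidPDE

/-! ## §C Vanishing of `J`-odd weighted integrals from the countable identities -/

/-- **Odd integrals from the countable family.** Let `t` be a determining family on `Q` (as in
`exists_testSeq`), `κ` a finite record on `Q`, `w` a measurable weight with `0 < w ≤ 1`, and
suppose `∫ (t m − t m ∘ J) w dκ = 0` for every `m`, `J q = (collide q.2 q.1, −q.2)` the inverse
collision. Then `∫ Ψ w dκ = 0` for every continuous `J`-odd `Ψ`: the finite measures `w · κ` and
its push-forward under `J` have the same integrals on the determining family, hence coincide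
(`ext_of_integral_family`), and `∫ Ψ d(w·κ) = ∫ Ψ ∘ J d(w·κ) = −∫ Ψ d(w·κ)`. [folklore] -/
theorem integral_odd_mul_eq_zero {t : ℕ → ((V3 × V3) × Metric.sphere (0 : V3) 1 →ᵇ ℝ≥0)}
    (ht : ∀ (μ μ' : Measure ((V3 × V3) × Metric.sphere (0 : V3) 1)) [IsFiniteMeasure μ]
      [IsFiniteMeasure μ'], (∀ m, ∫ x, (t m x : ℝ) ∂μ ≤ ∫ x, (t m x : ℝ) ∂μ') →
      ∀ F, IsClosed F → μ F ≤ μ' F)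
    (κ : Measure ((V3 × V3) × Metric.sphere (0 : V3) 1)) [IsFiniteMeasure κ]
    {w : (V3 × V3) × Metric.sphere (0 : V3) 1 → ℝ}
    (hwm : Measurable w) (hw0 : ∀ q, 0 < w q) (hw1 : ∀ q, w q ≤ 1)
    (h : ∀ m, ∫ q, ((t m q : ℝ) - (t m (collide q.2 q.1, -q.2) : ℝ)) * w q ∂κ = 0)
    {Ψ : (V3 × V3) × Metric.sphere (0 : V3) 1 → ℝ} (hΨc : Continuous Ψ)
    (hΨo : ∀ q, Ψ (collide q.2 q.1, -q.2) = -Ψ q) :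
    ∫ q, Ψ q * w q ∂κ = 0 := by
  have hJm : Measurable fun q : (V3 × V3) × Metric.sphere (0 : V3) 1 => (collide q.2 q.1, -q.2) :=
    ParityBandClosureDetailedBalance.measurable_inverseCollision
  have hwb : ∀ᵐ q ∂κ, ‖w q‖ ≤ 1 :=
    ae_of_all _ fun q => by rw [Real.norm_eq_abs, abs_of_pos (hw0 q)]; exact hw1 q
  have hwi : Integrable w κ := Integrable.of_bound hwm.aestronglyMeasurable 1 hwb
  haveI : IsFiniteMeasure (κ.withDensity fun q => ENNReal.ofReal (w q)) :=
    isFiniteMeasure_withDensity_ofReal hwi.2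
  -- integrals against `w · κ`
  have hint : ∀ g : (V3 × V3) × Metric.sphere (0 : V3) 1 → ℝ,
      ∫ q, g q ∂(κ.withDensity fun q => ENNReal.ofReal (w q)) = ∫ q, g q * w q ∂κ := by
    intro g
    rw [integral_withDensity_eq_integral_toReal_smul hwm.ennreal_ofReal
      (ae_of_all _ fun _ => ENNReal.ofReal_lt_top)]
    refine integral_congr_ae (ae_of_all _ fun q => ?_)
    dsimp only
    rw [ENNReal.toReal_ofReal (hw0 q).le, smul_eq_mul, mul_comm]
  -- integrals against its push-forward under `J`
  have hmap : ∀ g : (V3 × V3) × Metric.sphere (0 : V3) 1 → ℝ, Continuous g →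
      ∫ q, g q ∂((κ.withDensity fun q => ENNReal.ofReal (w q)).map
        fun q => (collide q.2 q.1, -q.2)) = ∫ q, g (collide q.2 q.1, -q.2) * w q ∂κ := by
    intro g hg
    rw [integral_map hJm.aemeasurable hg.aestronglyMeasurable, hint]
  -- the two finite measures coincide
  have hext : (κ.withDensity fun q => ENNReal.ofReal (w q)).map
      (fun q => (collide q.2 q.1, -q.2)) = κ.withDensity fun q => ENNReal.ofReal (w q) := by
    refine ext_of_integral_family ht fun m => ?_
    rw [hmap (fun q => (t m q : ℝ)) (NNReal.continuous_coe.comp (t m).continuous), hint]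
    have h1 : Integrable (fun q => (t m q : ℝ) * w q) κ :=
      ((t m).integrable_of_nnreal κ).mul_bdd hwm.aestronglyMeasurable hwb
    have h2 : Integrable (fun q : (V3 × V3) × Metric.sphere (0 : V3) 1 =>
        (t m (collide q.2 q.1, -q.2) : ℝ) * w q) κ := by
      refine Integrable.mul_bdd ?_ hwm.aestronglyMeasurable hwb
      exact ((t m).integrable_of_nnreal _).comp_measurable hJm
    have h3 := h m
    simp only [sub_mul] at h3
    rw [integral_sub h1 h2, sub_eq_zero] at h3
    exact h3.symm
  -- conclusion
  have key : ∫ q, Ψ q * w q ∂κ = -∫ q, Ψ q * w q ∂κ := by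
    calc ∫ q, Ψ q * w q ∂κ = ∫ q, Ψ q ∂(κ.withDensity fun q => ENNReal.ofReal (w q)) :=
          (hint Ψ).symm
      _ = ∫ q, Ψ q ∂((κ.withDensity fun q => ENNReal.ofReal (w q)).map
            fun q => (collide q.2 q.1, -q.2)) := by rw [hext]
      _ = ∫ q, Ψ (collide q.2 q.1, -q.2) * w q ∂κ := hmap Ψ hΨc
      _ = ∫ q, -(Ψ q * w q) ∂κ := by simp only [hΨo, neg_mul]
      _ = -∫ q, Ψ q * w q ∂κ := integral_neg _
  linarith

/-! ## §D The floor: absolute continuity of the ideal contact law -/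

/-- **Absolute continuity from the countable floor inequalities.** Let `t` be a determining family
on `Q`, `ν` a probability law on `V3` with finite second moment, `κ` a finite record on `Q`,
`c₀ > 0`, and `c₀ ∫ (t m) B d((ν⊗ν)⊗σ) ≤ ∫ t m dκ` for every `m`, `B` the flux weight. Then
`B · ((ν⊗ν)⊗σ) ≪ κ`: `B · ((ν⊗ν)⊗σ)` is finite because `B ≤ |v| + |w|`, the inequality passes to
all closed sets (`smul_measure_isClosed_le_of_family`), and a `κ`-null set has only `π`-null
closed subsets, hence is `π`-null by inner regularity of the finite Borel measure `π` on the metric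
space `Q`. [folklore] -/
theorem withDensity_fluxWeight_absolutelyContinuous
    {t : ℕ → ((V3 × V3) × Metric.sphere (0 : V3) 1 →ᵇ ℝ≥0)}
    (ht : ∀ (μ μ' : Measure ((V3 × V3) × Metric.sphere (0 : V3) 1)) [IsFiniteMeasure μ]
      [IsFiniteMeasure μ'], (∀ m, ∫ x, (t m x : ℝ) ∂μ ≤ ∫ x, (t m x : ℝ) ∂μ') →
      ∀ F, IsClosed F → μ F ≤ μ' F)
    (ν : Measure V3) [IsProbabilityMeasure ν]
    (κ : Measure ((V3 × V3) × Metric.sphere (0 : V3) 1)) [IsFiniteMeasure κ] {c₀ : ℝ}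
    (hc₀ : 0 < c₀) (hν2 : Integrable (fun v : V3 => ‖v‖ ^ 2) ν)
    (hf : ∀ m, c₀ * ∫ q, (t m q : ℝ) * hardSphereKernel (q.1.2, q.1.1) q.2
      ∂((ν.prod ν).prod sphereMeasure) ≤ ∫ q, (t m q : ℝ) ∂κ) :
    ((ν.prod ν).prod sphereMeasure).withDensity
      (fun q => ENNReal.ofReal (hardSphereKernel (q.1.2, q.1.1) q.2)) ≪ κ := by
  haveI : IsFiniteMeasure (sphereMeasure : Measure (Metric.sphere (0 : V3) 1)) := by
    unfold sphereMeasure; infer_instance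
  -- `B` is integrable: `B ≤ |v| + |w|` and `ν` has a first moment
  have hnorm : Integrable (fun v : V3 => ‖v‖) ν := by
    refine ((integrable_const (1 : ℝ)).add hν2).mono' continuous_norm.aestronglyMeasurable
      (ae_of_all _ fun v => ?_)
    rw [norm_norm]
    change ‖v‖ ≤ 1 + ‖v‖ ^ 2
    nlinarith [norm_nonneg v, sq_nonneg (‖v‖ - 1)]
  have hsum : Integrable (fun q : (V3 × V3) × Metric.sphere (0 : V3) 1 => ‖q.1.1‖ + ‖q.1.2‖)
      ((ν.prod ν).prod sphereMeasure) :=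
    ((hnorm.comp_fst ν).add (hnorm.comp_snd ν)).comp_fst sphereMeasure
  have hBi : Integrable (fun q : (V3 × V3) × Metric.sphere (0 : V3) 1 =>
      hardSphereKernel (q.1.2, q.1.1) q.2) ((ν.prod ν).prod sphereMeasure) := by
    refine hsum.mono' ParityBandClosureIsotropy.continuous_fluxWeight.aestronglyMeasurable
      (ae_of_all _ fun q => ?_)
    rw [Real.norm_eq_abs, abs_of_nonneg (ParityBandClosureIsotropy.fluxWeight_nonneg _ _)]
    unfold hardSphereKernel
    refine max_le ?_ (by positivity)
    calc ⟪q.1.2 - q.1.1, (q.2 : V3)⟫_ℝ ≤ ‖q.1.2 - q.1.1‖ * ‖(q.2 : V3)‖ := real_inner_le_norm _ _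
      _ = ‖q.1.2 - q.1.1‖ := by rw [norm_eq_of_mem_sphere q.2, mul_one]
      _ ≤ ‖q.1.2‖ + ‖q.1.1‖ := norm_sub_le _ _
      _ = ‖q.1.1‖ + ‖q.1.2‖ := add_comm _ _
  haveI : IsFiniteMeasure (((ν.prod ν).prod sphereMeasure).withDensity
      fun q : (V3 × V3) × Metric.sphere (0 : V3) 1 =>
        ENNReal.ofReal (hardSphereKernel (q.1.2, q.1.1) q.2)) :=
    isFiniteMeasure_withDensity_ofReal hBi.2
  -- the floor inequality on closed sets
  have hcl : ∀ F : Set ((V3 × V3) × Metric.sphere (0 : V3) 1), IsClosed F → ENNReal.ofReal c₀ *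
      ((ν.prod ν).prod sphereMeasure).withDensity
        (fun q => ENNReal.ofReal (hardSphereKernel (q.1.2, q.1.1) q.2)) F ≤ κ F := by
    intro F hF
    refine smul_measure_isClosed_le_of_family ht hc₀.le (fun m => ?_) hF
    rw [integral_withDensity_eq_integral_toReal_smul
      ParityBandClosureIsotropy.measurable_fluxWeight.ennreal_ofReal
      (ae_of_all _ fun _ => ENNReal.ofReal_lt_top)]
    refine le_of_eq_of_le ?_ (hf m)
    congr 1
    refine integral_congr_ae (ae_of_all _ fun q => ?_)
    dsimp only
    rw [ENNReal.toReal_ofReal (ParityBandClosureIsotropy.fluxWeight_nonneg _ _), smul_eq_mul,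
      mul_comm]
  -- absolute continuity by inner regularity
  refine Measure.AbsolutelyContinuous.mk fun s hs hκs => ?_
  rw [hs.measure_eq_iSup_isClosed_of_ne_top (measure_ne_top _ s)]
  simp only [ENNReal.iSup_eq_zero]
  intro F hFs hF
  have h1 := (hcl F hF).trans ((measure_mono hFs).trans hκs.le)
  have h2 : ENNReal.ofReal c₀ ≠ 0 := (ENNReal.ofReal_pos.2 hc₀).ne'
  exact (mul_eq_zero.1 (nonpos_iff_eq_zero.1 h1)).resolve_left h2

/-! ## §E The balance: equality of gain and loss marginals -/

/-- **Marginal identity from the countable balance identities.** Let `t` be a determining family on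
`V3` and `κ` a finite record on `Q`. If `∫ (t m (v′) + t m (w′) − t m (v) − t m (w)) dκ = 0` for every
`m`, then the gain marginals of `κ` equal its loss marginals:
`κ ∘ post₁⁻¹ + κ ∘ post₂⁻¹ = κ ∘ pre₁⁻¹ + κ ∘ pre₂⁻¹` (two finite measures on `V3` with the same
integrals on the determining family). [folklore] -/
theorem map_post_add_eq_map_pre_add {t : ℕ → (V3 →ᵇ ℝ≥0)}
    (ht : ∀ (μ μ' : Measure V3) [IsFiniteMeasure μ] [IsFiniteMeasure μ'],
      (∀ m, ∫ x, (t m x : ℝ) ∂μ ≤ ∫ x, (t m x : ℝ) ∂μ') → ∀ F, IsClosed F → μ F ≤ μ' F)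
    (κ : Measure ((V3 × V3) × Metric.sphere (0 : V3) 1)) [IsFiniteMeasure κ]
    (hb : ∀ m, ∫ q, ((t m (collide q.2 q.1).1 : ℝ) + t m (collide q.2 q.1).2 -
      t m q.1.1 - t m q.1.2) ∂κ = 0) :
    κ.map (fun q => (collide q.2 q.1).1) + κ.map (fun q => (collide q.2 q.1).2) =
      κ.map (fun q => q.1.1) + κ.map (fun q => q.1.2) := by
  have hf1 : Measurable fun q : (V3 × V3) × Metric.sphere (0 : V3) 1 => (collide q.2 q.1).1 :=
    continuous_collidePair.fst.measurable
  have hf2 : Measurable fun q : (V3 × V3) × Metric.sphere (0 : V3) 1 => (collide q.2 q.1).2 :=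
    continuous_collidePair.snd.measurable
  have hg1 : Measurable fun q : (V3 × V3) × Metric.sphere (0 : V3) 1 => q.1.1 :=
    measurable_fst.fst
  have hg2 : Measurable fun q : (V3 × V3) × Metric.sphere (0 : V3) 1 => q.1.2 :=
    measurable_fst.snd
  refine ext_of_integral_family ht fun m => ?_
  have htc : Continuous fun v => (t m v : ℝ) := NNReal.continuous_coe.comp (t m).continuous
  have hI : ∀ (μ : Measure V3) [IsFiniteMeasure μ], Integrable (fun v => (t m v : ℝ)) μ :=
    fun μ _ => (t m).integrable_of_nnreal μ
  have i1 : Integrable (fun q : (V3 × V3) × Metric.sphere (0 : V3) 1 =>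
      (t m (collide q.2 q.1).1 : ℝ)) κ := (hI _).comp_measurable hf1
  have i2 : Integrable (fun q : (V3 × V3) × Metric.sphere (0 : V3) 1 =>
      (t m (collide q.2 q.1).2 : ℝ)) κ := (hI _).comp_measurable hf2
  have i3 : Integrable (fun q : (V3 × V3) × Metric.sphere (0 : V3) 1 => (t m q.1.1 : ℝ)) κ :=
    (hI _).comp_measurable hg1
  have i4 : Integrable (fun q : (V3 × V3) × Metric.sphere (0 : V3) 1 => (t m q.1.2 : ℝ)) κ :=
    (hI _).comp_measurable hg2
  have i12 : Integrable (fun q : (V3 × V3) × Metric.sphere (0 : V3) 1 =>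
      (t m (collide q.2 q.1).1 : ℝ) + t m (collide q.2 q.1).2) κ := i1.add i2
  have i123 : Integrable (fun q : (V3 × V3) × Metric.sphere (0 : V3) 1 =>
      (t m (collide q.2 q.1).1 : ℝ) + t m (collide q.2 q.1).2 - t m q.1.1) κ := i12.sub i3
  rw [integral_add_measure (hI _) (hI _), integral_add_measure (hI _) (hI _),
    integral_map hf1.aemeasurable htc.aestronglyMeasurable,
    integral_map hf2.aemeasurable htc.aestronglyMeasurable,
    integral_map hg1.aemeasurable htc.aestronglyMeasurable,
    integral_map hg2.aemeasurable htc.aestronglyMeasurable]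
  have := hb m
  rw [integral_sub i123 i4, integral_sub i12 i3, integral_add i1 i2] at this
  linarith

/-! ## §F The statement and the theorem -/

/-- **Countable determining test families** (verbatim copy of the waypoint of the line
`transfer-weighted-parity-chain`, skeleton v3).  There are countably many bounded continuous `Φ_i`
on `Q`, nonneg bounded continuous `Ξ_i` on `Q`, bounded continuous `c_i` on `ℝ³` and bandwidths
`ϑ_k ∈ (0,1)` such that, for every probability law `ν` with finite second moment, every finite
record `κ` and every `c₀ > 0`, the EXACT countable identities — (o)
`∫ (Φ_i − Φ_i ∘ J) min(1,e^{−F^ν_{ϑ_k}}) dκ = 0` for all `i,k`; (f) `c₀ ∫ Ξ_i B d((ν⊗ν)⊗σ) ≤ ∫ Ξ_i dκ`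
for all `i`; (b) `∫ Δc_i dκ = 0` for all `i` — imply the three hypotheses of
`ExactParityRigidity`: vanishing of all bounded continuous `J`-odd Metropolis-weighted integrals
at every `ϑ ∈ (0,1)`, `B · ((ν⊗ν)⊗σ) ≪ κ`, and the gain/loss marginal identity. -/
def CountableTestUpgrade : Prop :=
  ∃ (Φ₀ : ℕ → (V3 × V3) × Metric.sphere (0 : V3) 1 → ℝ)
    (Ξ₀ : ℕ → (V3 × V3) × Metric.sphere (0 : V3) 1 → ℝ) (C₀ : ℕ → V3 → ℝ) (ϑ₀ : ℕ → ℝ),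
    (∀ i, Continuous (Φ₀ i) ∧ ∃ C : ℝ, ∀ q, |Φ₀ i q| ≤ C) ∧
    (∀ i, Continuous (Ξ₀ i) ∧ (∀ q, 0 ≤ Ξ₀ i q) ∧ ∃ C : ℝ, ∀ q, Ξ₀ i q ≤ C) ∧
    (∀ i, Continuous (C₀ i) ∧ ∃ C : ℝ, ∀ v, |C₀ i v| ≤ C) ∧
    (∀ k, 0 < ϑ₀ k ∧ ϑ₀ k < 1) ∧
    ∀ (ν : Measure V3) [IsProbabilityMeasure ν] (κ : Measure ((V3 × V3) × Metric.sphere (0 : V3) 1))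
      [IsFiniteMeasure κ] (c₀ : ℝ), 0 < c₀ →
      Integrable (fun v : V3 => ‖v‖ ^ 2) ν →
      let h : ℝ → V3 → ℝ := fun ϑ v => ∫ v', localMaxwellian 1 (ϑ ^ 2) v v' ∂ν
      let F : ℝ → (V3 × V3) × Metric.sphere (0 : V3) 1 → ℝ := fun ϑ q =>
        Real.log (h ϑ q.1.1) + Real.log (h ϑ q.1.2) -
          Real.log (h ϑ (collide q.2 q.1).1) - Real.log (h ϑ (collide q.2 q.1).2)
      (∀ i k, ∫ q, (Φ₀ i q - Φ₀ i (collide q.2 q.1, -q.2)) * min 1 (Real.exp (-(F (ϑ₀ k) q))) ∂κ = 0) →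
      (∀ i, c₀ * ∫ q, Ξ₀ i q * hardSphereKernel (q.1.2, q.1.1) q.2 ∂((ν.prod ν).prod sphereMeasure) ≤
        ∫ q, Ξ₀ i q ∂κ) →
      (∀ i, ∫ q, (C₀ i (collide q.2 q.1).1 + C₀ i (collide q.2 q.1).2 - C₀ i q.1.1 - C₀ i q.1.2) ∂κ = 0) →
      (∀ ϑ : ℝ, 0 < ϑ → ϑ < 1 → ∀ Ψ : (V3 × V3) × Metric.sphere (0 : V3) 1 → ℝ, Continuous Ψ →
        (∃ C : ℝ, ∀ q, |Ψ q| ≤ C) → (∀ q, Ψ (collide q.2 q.1, -q.2) = -Ψ q) →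
        ∫ q, Ψ q * min 1 (Real.exp (-(F ϑ q))) ∂κ = 0) ∧
      (((ν.prod ν).prod sphereMeasure).withDensity
          (fun q => ENNReal.ofReal (hardSphereKernel (q.1.2, q.1.1) q.2)) ≪ κ) ∧
      (κ.map (fun q => (collide q.2 q.1).1) + κ.map (fun q => (collide q.2 q.1).2) =
        κ.map (fun q => q.1.1) + κ.map (fun q => q.1.2))

/-- **The stub `stub_countableTestUpgrade`** (line `transfer-weighted-parity-chain`, crux
`ParityBandClosure`, stmt-AtomisticToContinuum-17608): countable determining test families exist.
Families: `Φ_i = Ξ_i = t_Q i` and `c_i = t_{V3} i`, the determining families of `exists_testSeq` on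
`Q` and on `V3` (outer approximations of the indicators of complements of finite unions of basic
open sets), `ϑ_k` the dense bandwidth sequence of `stub_countableTestUpgradeA`.  (o)
`integral_odd_mul_eq_zero` at each `ϑ_k`, then `continuousOn_oddIntegral` (with `continuousOn_kde`,
`integral_localMaxwellian_pos`, `measurable_integral_localMaxwellian`) + `eq_zero_of_mem_closure`;
(f) `withDensity_fluxWeight_absolutelyContinuous`; (b) `map_post_add_eq_map_pre_add`. [folklore] -/
theorem stub_countableTestUpgrade : CountableTestUpgrade := by
  obtain ⟨tQ, htQ1, htQ⟩ := exists_testSeq ((V3 × V3) × Metric.sphere (0 : V3) 1)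
  obtain ⟨tV, htV1, htV⟩ := exists_testSeq V3
  obtain ⟨ϑ₀, hϑ₀, hdense⟩ := stub_countableTestUpgradeA
  have hb1 : ∀ {Y : Type} [TopologicalSpace Y] (f : Y →ᵇ ℝ≥0), (∀ y, f y ≤ 1) →
      ∀ y, |(f y : ℝ)| ≤ 1 := fun f hf y => by
    rw [abs_of_nonneg (NNReal.coe_nonneg _)]
    exact NNReal.coe_le_one.2 (hf y)
  refine ⟨fun i q => (tQ i q : ℝ), fun i q => (tQ i q : ℝ), fun i v => (tV i v : ℝ), ϑ₀,
    fun i => ⟨NNReal.continuous_coe.comp (tQ i).continuous, 1, hb1 (tQ i) (htQ1 i)⟩,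
    fun i => ⟨NNReal.continuous_coe.comp (tQ i).continuous, fun q => NNReal.coe_nonneg _, 1,
      fun q => NNReal.coe_le_one.2 (htQ1 i q)⟩,
    fun i => ⟨NNReal.continuous_coe.comp (tV i).continuous, 1, hb1 (tV i) (htV1 i)⟩, hϑ₀, ?_⟩
  intro ν _ κ _ c₀ hc₀ hν2 h F ho hf hb
  refine ⟨fun ϑ hϑ0 hϑ1 Ψ hΨc hΨb hΨo => ?_,
    withDensity_fluxWeight_absolutelyContinuous htQ ν κ hc₀ hν2 hf,
    map_post_add_eq_map_pre_add htV κ hb⟩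
  obtain ⟨C, hC⟩ := hΨb
  refine eq_zero_of_mem_closure (fun k => (hϑ₀ k).1.ne')
    (continuousOn_oddIntegral (fun ϑ => ParityRigidity.measurable_integral_localMaxwellian ν ϑ)
      (continuousOn_kde ν) (fun ϑ hϑ v => ParityRigidity.integral_localMaxwellian_pos ν hϑ v)
      κ hΨc hC)
    (fun k => ?_) hϑ0.ne' (hdense ϑ hϑ0 hϑ1)
  exact integral_odd_mul_eq_zero htQ κ
    (measurable_weight (ParityRigidity.measurable_integral_localMaxwellian ν _))
    (fun q => ParityBandClosureDetailedBalance.min_one_exp_neg_pos _) (fun q => min_le_left _ _)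
    (fun m => ho m k) hΨc hΨo

end Summit.AtomisticToContinuum.HydrodynamicLimit.Theorems.ParityBandClosureCountableUpgrade

end
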